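import Literature.NumberTheory.EllipticCurves.HuShuYin2019.SylvesterThreePart
import Literature.NumberTheory.EllipticCurves.Kriz2020.SylvesterProofs
import Literature.NumberTheory.EllipticCurves.BSDInvariantsProofs
import Literature.NumberTheory.EllipticCurves.LFunctionSmulProofs
import Literature.NumberTheory.EllipticCurves.GlobalMinimalModelProofs
import Literature.NumberTheory.EllipticCurves.SelmerCorankHolds
import Literature.NumberTheory.EllipticCurves.IwasawaLeadingTermProofs
import HarnessLib

/-!
# Hu–Shu–Yin 2019, Thm. 1.3 (1) on the displayed model: for every prime `p ≡ 4, 7 (mod 9)` with `3` not a cube mod `p`, the Sylvester curve `E_p : y² = x³ − 432 p²` has `rank E_p(ℚ) = 1 = ord_{s=1} L(E_p, s)`, `Ш(E_p)` finite, `corank_{ℤ₃} Sel_{3^∞}(E_p) = 1`, and `p` is a sum of two rational cubes (Dasgupta–Voight 2018)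

Pure proofs, no new definitions and no new named facts (D-0026). The tree vendors
Hu–Shu–Yin, *An explicit Gross–Zagier formula related to the Sylvester conjecture*, Trans. Amer.
Math. Soc. **372** (2019) 6905–6925 (doi:10.1090/tran/7760 = arXiv:1708.05266), Thm. 1.4 together
with the parts of Thm. 1.3 it rests on, as the named fact `HuShuYin2019.thm14_threePart_product`
(`SylvesterThreePart.lean`), stated for GLOBALLY MINIMAL models `B ≅ E_p`, `A ≅ E_{3p²}`. Thm. 1.3
there (p. 3 of the arXiv text, `paper:arxiv-1708.05266` p0003 L32–36) is printed as "known": "Let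
`p ≡ 4, 7 mod 9` be a rational prime number such that `3 mod p` is not a cubic residue. Then
(1) `ord_{s=1} L(s, E_p) = rk_ℤ E_p(ℚ) = 1`; (2) `Ш(E_p)` is finite …" — from Dasgupta–Voight,
Proc. AMS 146 (2018) Thm. 2 (non-torsion mock Heegner points: `rank E_p = rank E_{p²} = 1`) with
Gross–Zagier–Kolyvagin (HSY p. 3 L28). This file reads conclusion (1)–(2) back on the DISPLAYED
model the rest of the tree uses for `x³ + y³ = p`, namely `mordellCurve (−432 p²) = ⟨0,0,0,0,−432p²⟩`
(`MordellCurveThreeDescent`, `Kriz2020/SylvesterProofs`, `CubeSumPrimeDescentInputs`), which is HSY's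
`cubeSumCurve p` on the nose (`cubeSumCurve_eq_mordellCurve`): a global minimal model exists
(`hasGlobalMinimalModel_rat_holds`, Néron), the fact applies to it, and rank / analytic rank /
finiteness of `Ш` are invariant under the change of variables (`mordellWeilRank_variableChange_holds`,
`analyticRank_smul`, `shaEquiv`). Consequences, all modulo the single binder
`h14 : thm14_threePart_product` (refereed, FAMILY-shaped):

* `rank_analyticRank_sha_dv_family` — `rank = 1 ∧ ord_{s=1} L = 1 ∧ Ш finite` for `E_p`;
* `selmerCorank_three_eq_one_dv_family` — `corank_{ℤ₃} Sel_{3^∞}(E_p/ℚ) = 1` (Greenberg's corank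
  identity): on this family the HYPOTHESIS of the rank-one `3`-converse
  `rankOne_threeConverse_mordellCurve` (`Kriz2020/RankOnePConverse.lean`, rung S2b of the BSD
  ladder, cell `bsd-cn100`) holds and so does its CONCLUSION — the sub-family of the Sylvester
  family on which that converse is already refereed print (LIT-G15-ADDENDUM §7);
* `exists_cube_add_cube_prime_dv_family` — `p = x³ + y³` with `x, y ∈ ℚ` (Dasgupta–Voight 2018,
  Thm. 1.2 of HSY, the `p` half), via a point of infinite order on `E_p` and the tree's dictionary
  `exists_cube_add_cube_of_mordellCurve_equation`.

References: [HuShuYin2019] Thm. 1.3 (1)–(2), Thm. 1.4; [DasguptaVoight2018] Thm. 2 (= HSY Thm. 1.2);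
[SilvermanAEC2009] VIII.8 (minimal models), III.3.1(b), X.§4, App. C §16 (invariance).
-/

noncomputable section

open scoped Classical

open WeierstrassCurve Literature.NumberTheory.EllipticCurves

namespace Literature.NumberTheory.EllipticCurves.HuShuYin2019

/-- HSY's model `cubeSumCurve n = ⟨0,0,0,0,−432n²⟩` IS the tree's displayed model
`mordellCurve (−432 n²)` of `x³ + y³ = n` — the Weierstrass equation `y² = x³ − 432n²` of `E_n`
printed in Dasgupta–Voight 2018 §1.1 and Hu–Shu–Yin 2019 §1 (same identity as
`Kriz2020/SylvesterProofs.lean`'s model bookkeeping). [cite: DasguptaVoight2018, §1.1 (the Weierstrass equation y² = x³ − 432n² of E_n)]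
[cite: HuShuYin2019, §1 (E_p : y² = x³ − 432p², arXiv p. 3)] -/
theorem cubeSumCurve_eq_mordellCurve (n : ℚ) : cubeSumCurve n = mordellCurve (-(432 * n ^ 2)) := by
  simp only [cubeSumCurve, mordellCurve]; congr 1; ring

/-- `−432 n² ≠ 0` for `n ≠ 0` (the displayed model is an elliptic curve). [folklore] -/
private theorem neg_mul_sq_ne_zero {n : ℚ} (hn : n ≠ 0) : (-(432 * n ^ 2) : ℚ) ≠ 0 :=
  neg_ne_zero.mpr (mul_ne_zero (by norm_num) (pow_ne_zero 2 hn))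

/-- **Hu–Shu–Yin 2019, Thm. 1.3 (1)–(2), on the displayed model** (modulo the refereed named fact
`h14 = thm14_threePart_product`): for a prime `p ≡ 4, 7 (mod 9)` such that `3` is not a cube
mod `p`, `E_p = mordellCurve (−432 p²)` has `rank E_p(ℚ) = 1`, `ord_{s=1} L(E_p, s) = 1` and `Ш(E_p)`
finite. Proof: apply the fact to global minimal models of `E_p` and `E_{3p²}` (Néron,
`hasGlobalMinimalModel_rat_holds`) and transport back (`mordellWeilRank_variableChange_holds`,
`analyticRank_smul`, `shaEquiv`).
[cite: HuShuYin2019, Thm. 1.3 (1)–(2) (arXiv:1708.05266 p. 3 L32–L36)] [cite: DasguptaVoight2018, Thm. 2] -/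
theorem rank_analyticRank_sha_dv_family (h14 : thm14_threePart_product) {p : ℕ} (hp : p.Prime)
    (h9 : p % 9 = 4 ∨ p % 9 = 7) (h3 : ¬ ∃ x : ZMod p, x ^ 3 = 3) :
    (mordellCurve (-(432 * (p : ℚ) ^ 2))).mordellWeilRank = 1 ∧
      (mordellCurve (-(432 * (p : ℚ) ^ 2))).analyticRank = 1 ∧
      Finite (mordellCurve (-(432 * (p : ℚ) ^ 2))).sha := by
  have hp0 : (p : ℚ) ≠ 0 := by exact_mod_cast hp.ne_zero
  haveI hW : (cubeSumCurve (p : ℚ)).IsElliptic := by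
    rw [cubeSumCurve_eq_mordellCurve]; exact isElliptic_mordellCurve (neg_mul_sq_ne_zero hp0)
  haveI hW' : (cubeSumCurve (3 * (p : ℚ) ^ 2)).IsElliptic := by
    rw [cubeSumCurve_eq_mordellCurve]
    exact isElliptic_mordellCurve
      (neg_mul_sq_ne_zero (mul_ne_zero (by norm_num) (pow_ne_zero 2 hp0)))
  obtain ⟨C, hC⟩ := hasGlobalMinimalModel_rat_holds (cubeSumCurve (p : ℚ))
  obtain ⟨C', hC'⟩ := hasGlobalMinimalModel_rat_holds (cubeSumCurve (3 * (p : ℚ) ^ 2))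
  haveI := hC; haveI := hC'
  obtain ⟨hrk, han, hfin, -⟩ := h14 p hp h9 h3 (C' • cubeSumCurve (3 * (p : ℚ) ^ 2))
    (C • cubeSumCurve (p : ℚ)) ⟨C⁻¹, inv_smul_smul C _⟩ ⟨C'⁻¹, inv_smul_smul C' _⟩
  rw [mordellWeilRank_variableChange_holds] at hrk
  rw [analyticRank_smul] at han
  have hfin' : Finite (cubeSumCurve (p : ℚ)).sha := Finite.of_equiv _ (shaEquiv _ C).symm
  rw [← cubeSumCurve_eq_mordellCurve]
  exact ⟨hrk, han, hfin'⟩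

/-- **`corank_{ℤ₃} Sel_{3^∞}(E_p/ℚ) = 1` on the Dasgupta–Voight family** (prime `p ≡ 4, 7 (mod 9)`,
`3` not a cube mod `p`), modulo `h14`: rank `1` and `Ш` finite (`rank_analyticRank_sha_dv_family`)
with Greenberg's corank identity (`selmerCorank_eq_mordellWeilRank_add_holds`,
`finite_primaryComponent_sha_iff_shaCorank_eq_zero`). So on this family the hypothesis AND the
conclusion of the rank-one `3`-converse `rankOne_threeConverse_mordellCurve` both hold.
[cite: HuShuYin2019, Thm. 1.3 (1)–(2)] [cite: Greenberg1999LNM, §1 pp. 54–57] -/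
theorem selmerCorank_three_eq_one_dv_family (h14 : thm14_threePart_product) {p : ℕ} (hp : p.Prime)
    (h9 : p % 9 = 4 ∨ p % 9 = 7) (h3 : ¬ ∃ x : ZMod p, x ^ 3 = 3) :
    haveI := isElliptic_mordellCurve (neg_mul_sq_ne_zero (show (p : ℚ) ≠ 0 by exact_mod_cast hp.ne_zero))
    haveI : Fact (Nat.Prime 3) := ⟨Nat.prime_three⟩
    (mordellCurve (-(432 * (p : ℚ) ^ 2))).selmerCorank 3 = 1 := by
  haveI := isElliptic_mordellCurve (neg_mul_sq_ne_zero (show (p : ℚ) ≠ 0 by exact_mod_cast hp.ne_zero))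
  haveI : Fact (Nat.Prime 3) := ⟨Nat.prime_three⟩
  obtain ⟨hr, -, hfin⟩ := rank_analyticRank_sha_dv_family h14 hp h9 h3
  have hfin3 : Finite (AddCommGroup.primaryComponent (mordellCurve (-(432 * (p : ℚ) ^ 2))).sha 3) := by
    haveI := hfin; infer_instance
  simp only [(mordellCurve (-(432 * (p : ℚ) ^ 2))).selmerCorank_eq_mordellWeilRank_add_holds 3, hr,
    (finite_primaryComponent_sha_iff_shaCorank_eq_zero (mordellCurve (-(432 * (p : ℚ) ^ 2))) 3).1
      hfin3]

/-- **Dasgupta–Voight 2018 (= Hu–Shu–Yin Thm. 1.2, the `p` half): every prime `p ≡ 4, 7 (mod 9)`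
with `3` not a cube mod `p` is a sum of two rational cubes**, modulo `h14`: `rank E_p(ℚ) = 1 ≠ 0`
gives an affine rational point on `y² = x³ − 432p²` (`exists_nonsingular_ne_zero_of_mordellWeilRank_ne_zero`),
which the tree's dictionary `exists_cube_add_cube_of_mordellCurve_equation` turns into
`p = x³ + y³`. [cite: DasguptaVoight2018, Thm. 2] [cite: HuShuYin2019, Thm. 1.2 (arXiv p. 3 L24–L26)] -/
theorem exists_cube_add_cube_prime_dv_family (h14 : thm14_threePart_product) {p : ℕ}
    (hp : p.Prime) (h9 : p % 9 = 4 ∨ p % 9 = 7) (h3 : ¬ ∃ x : ZMod p, x ^ 3 = 3) :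
    ∃ x y : ℚ, x ^ 3 + y ^ 3 = p := by
  have hp0 : (p : ℚ) ≠ 0 := by exact_mod_cast hp.ne_zero
  haveI := isElliptic_mordellCurve (neg_mul_sq_ne_zero hp0)
  have hMW := (rank_analyticRank_sha_dv_family h14 hp h9 h3).1
  obtain ⟨X, Y, hXY, -⟩ := exists_nonsingular_ne_zero_of_mordellWeilRank_ne_zero
    (mordellCurve (-(432 * (p : ℚ) ^ 2))) rfl rfl (by rw [hMW]; exact one_ne_zero)
  exact exists_cube_add_cube_of_mordellCurve_equation hp0 hXY.1

end Literature.NumberTheory.EllipticCurves.HuShuYin2019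

end
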